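import Mathlib
import Summits.ResolutionOfSingularities.ResolutionOfSingularities.Theses.HomologicalConductor
import Summits.ResolutionOfSingularities.ResolutionOfSingularities.Theorems.HomologicalConductorStrictDropReground
import Summits.ResolutionOfSingularities.ResolutionOfSingularities.Theorems.HomologicalConductorStrictDropRegroundGeneral
import Summits.ResolutionOfSingularities.ResolutionOfSingularities.Theorems.HomologicalConductorStrictDropDimLEOne
import Summits.ResolutionOfSingularities.ResolutionOfSingularities.Theorems.HomologicalConductorStrictDropTowerShape
import Summits.ResolutionOfSingularities.ResolutionOfSingularities.Theorems.HomologicalConductorStrictDropRegularDrop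
import Summits.ResolutionOfSingularities.ResolutionOfSingularities.Theorems.HomologicalConductorNoZenoDiscreteDominator
import Summits.ResolutionOfSingularities.ResolutionOfSingularities.Theorems.HomologicalConductorSurfaceTerminationReduction
import HarnessLib

/-!
# Crux `NoZenoR` (stmt-ResolutionOfSingularities-19943) — DOOR: the crux follows from the kill test
# `SurfaceTermination` (stmt-16488) together with termination of the towers ALL of whose stages have Krull
# dimension `≥ 3`

Route `ResolutionOfSingularities/HomologicalConductor`; Birth vocabulary `NoZeno.Birth.tower`.  OURS (cell decomp-res,
hand leafhand-res-homologicalconduct-3); AI-written support lemmas, weaker than expert review; nothing here is a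
statement of any manuscript under review.  SUPPORT-level: the two theorems conclude the crux `NoZenoR` BY NAME under
hypotheses (conditional doors, not closures); resolution of singularities in positive characteristic is NOT proved.

`NoZenoR` is `PersistenceRadical → StrictDrop → (every admissible datum's canonical tower reaches a regular stage)`
(`DiscreteDominator.noZenoR_iff`), and `PersistenceRadical` is a theorem of the tree (`persistenceRadical_proof`).
By the landed dimension bookkeeping of this hand — stages have NON-INCREASING Krull dimension
(`HomologicalConductorStrictDropTowerDimAntitone`), a singular stage of dimension `≤ 1` is followed by a regular
one (S1, `DimLEOne.stub_dimLEOne_succ_regular`), and a stage of dimension `2` forces termination under the kill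
test for EVERY valuation and residue field (`Reground.exists_isRegularLocalRing_tower_of_ringKrullDim_eq_two`,
re-grounding over a lifted transcendence basis) — the crux is reduced to the towers whose stages ALL have
dimension `≥ 3`:

* `noZenoR_of_surfaceTermination_of_highDim` — **`NoZenoR` ⟸ `SurfaceTermination` + (H≥3)**, where (H≥3) says:
  under `StrictDrop`, every admissible datum all of whose stages have Krull dimension `≥ 3` (`¬ dim T_n ≤ 2` for
  all `n`) reaches a regular stage.  Fact-free.
* **`noZenoR_of_surfaceTermination_of_topDim`** — the sharper residual (TOP): under `StrictDrop`, every admissible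
  datum with `dim A ≥ 3` ALL of whose stages keep the top dimension `dim A` (all centres closed points) reaches a
  regular stage.  Via re-grounding in every dimension (`Reground.exists_reground`,
  `HomologicalConductorStrictDropRegroundGeneral`): a terminal run of dimension `e ≥ 3` is the top-dimensional tower
  of an `F`-datum of dimension `e`.
* `noZenoR_of_facts_of_topDim` — the same with the kill test replaced by the six published surface facts, through
  the tree's `SurfaceTermination.Reduction.surfaceTermination_of_strictDrop` (`StrictDrop → SurfaceTermination`
  modulo CJS 2020, Lipman (1.2), (4.1), (12.1)(i),(ii), Görtz–Wedhorn 24.44).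
* `strictDrop_of_forall_terminates` (universal termination ⇒ `StrictDrop`, SC + persistence),
  `forall_terminates_of_surfaceTermination_of_topDim'`, **`strictDrop_of_surfaceTermination_of_topDim'`**,
  **`noZenoR_of_surfaceTermination_of_topDim'`** — without `StrictDrop` as a hypothesis: BOTH open cruxes of the
  route follow from the kill test + (TOP′) «every admissible datum of dimension `≥ 3` whose tower keeps the top
  dimension reaches a regular stage» (= termination of the canonical `ca`-tower along valuations with closed-point
  centres in dimension `≥ 3`).
So what is crux-sized in `NoZenoR` beyond the kill test is exactly (TOP): termination, under `StrictDrop`, of the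
canonical towers of data of dimension `d ≥ 3` along valuations all of whose centres are closed points (e.g. the
zero-dimensional valuations, `HomologicalConductorStrictDropTowerDimResiduallyAlgebraic`); valuations with
transcendental residues at some stage are absorbed by re-grounding.

References (mechanism only): H. Matsumura, *Commutative Ring Theory*, Thm. 5.6 [`Matsumura1987`].
-/

noncomputable section

-- single-problem summit: the doubled namespace component `ResolutionOfSingularities` is forced
set_option linter.dupNamespace false

open Summit.ResolutionOfSingularities.ResolutionOfSingularities.Theses.HomologicalConductor
  (NoZenoR StrictDrop SurfaceTermination PersistenceRadical)

namespace Summit.ResolutionOfSingularities.ResolutionOfSingularities.Theorems.NoZeno.Birth.HighDimDoor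

/-- **A stage of Krull dimension `≤ 2` forces termination, given the kill test** (every field, every valuation):
dimension `≤ 1` — the stage or its successor is regular (S1, `DimLEOne.stub_dimLEOne_succ_regular`); dimension `2` —
re-grounding and the kill test (`Reground.exists_isRegularLocalRing_tower_of_ringKrullDim_eq_two`). [folklore] -/
theorem exists_isRegularLocalRing_tower_of_ringKrullDim_le_two (hS : SurfaceTermination)
    (p : ℕ) (hp : p.Prime) (k K : Type) [Field k] [CharP k p] [Field K] [Algebra k K]
    (O : ValuationSubring K) (A : Subalgebra k K) (hk : ∀ c : k, algebraMap k K c ∈ O) (hA : A.FG)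
    (hfr : IsFractionRing ↥A K) (hAO : A.toSubring ≤ O.toSubring) (n : ℕ)
    (hn : ringKrullDim ↥(tower O A n) ≤ 2) : ∃ m : ℕ, IsRegularLocalRing ↥(tower O A m) := by
  obtain ⟨e, he, -⟩ := exists_ringKrullDim_tower_eq_nat O A hA hfr n
  by_cases he1 : e ≤ 1
  · by_cases hreg : IsRegularLocalRing ↥(tower O A n)
    · exact ⟨n, hreg⟩
    · have hdim1 : ringKrullDim ↥(tower O A n) ≤ 1 := by rw [he]; exact_mod_cast he1
      have hshape := StrictDrop.Birth.TowerShape.stub_towerShape p hp k K O A hk hA hfr hAO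
      exact ⟨n + 1, StrictDrop.Birth.DimLEOne.stub_dimLEOne_succ_regular p hp k K O A hk hA hfr hAO
        hshape n hdim1 hreg⟩
  · have he2 : e = 2 := by
      have h2 : e ≤ 2 := by
        rw [he] at hn
        exact_mod_cast hn
      omega
    rw [he2] at he
    exact Reground.exists_isRegularLocalRing_tower_of_ringKrullDim_eq_two hS p hp k K O A hk hA hfr hAO n
      (by exact_mod_cast he)

/-- **`NoZenoR` ⟸ the kill test + termination of the towers all of whose stages have Krull dimension `≥ 3`**
(fact-free): by `exists_isRegularLocalRing_tower_of_ringKrullDim_le_two` only data all of whose stages have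
dimension `≥ 3` are left, and those are the hypothesis. [folklore] -/
theorem noZenoR_of_surfaceTermination_of_highDim (hS : SurfaceTermination)
    (hHigh : StrictDrop → ∀ p : ℕ, p.Prime → ∀ (k K : Type) [Field k] [CharP k p] [Field K] [Algebra k K]
      (O : ValuationSubring K) (A : Subalgebra k K), (∀ c : k, algebraMap k K c ∈ O) → A.FG →
      IsFractionRing ↥A K → A.toSubring ≤ O.toSubring →
      (∀ n : ℕ, ¬ ringKrullDim ↥(tower O A n) ≤ 2) → ∃ m : ℕ, IsRegularLocalRing ↥(tower O A m)) :
    NoZenoR := by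
  refine DiscreteDominator.noZenoR_iff.mpr fun _ hD p hp k K _ _ _ _ O A hk hA hfr hAO => ?_
  by_cases hlow : ∃ n : ℕ, ringKrullDim ↥(tower O A n) ≤ 2
  · obtain ⟨n, hn⟩ := hlow
    exact exists_isRegularLocalRing_tower_of_ringKrullDim_le_two hS p hp k K O A hk hA hfr hAO n hn
  · exact hHigh hD p hp k K O A hk hA hfr hAO fun n hn => hlow ⟨n, hn⟩

/-- **`NoZenoR` ⟸ the kill test + termination of the TOP-DIMENSIONAL towers of dimension `≥ 3`** (fact-free; the
sharper residual).  (TOP): under `StrictDrop`, every admissible datum with `dim A ≥ 3` ALL of whose stages keep the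
Krull dimension `dim A` (every centre of `O` along the tower is a closed point) reaches a regular stage.  Proof: the
stage dimension is eventually constant `= e` (`exists_ringKrullDim_tower_eventually_eq`); `e ≤ 2` is
`exists_isRegularLocalRing_tower_of_ringKrullDim_le_two`; for `e ≥ 3` re-ground at the first stage of the terminal
run (`Reground.exists_reground`): over the purely transcendental `F ⊆ O` the same tower is the tower of a finitely
generated `F`-datum `A'` with `dim A' = e`, all of whose stages have dimension `e` — a TOP-dimensional tower — and
`StrictDrop`, quantified over all fields, applies to it. [folklore] -/
theorem noZenoR_of_surfaceTermination_of_topDim (hS : SurfaceTermination)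
    (hTop : StrictDrop → ∀ p : ℕ, p.Prime → ∀ (k K : Type) [Field k] [CharP k p] [Field K] [Algebra k K]
      (O : ValuationSubring K) (A : Subalgebra k K), (∀ c : k, algebraMap k K c ∈ O) → A.FG →
      IsFractionRing ↥A K → A.toSubring ≤ O.toSubring → ¬ ringKrullDim ↥A ≤ 2 →
      (∀ n : ℕ, ringKrullDim ↥(tower O A n) = ringKrullDim ↥A) → ∃ m : ℕ, IsRegularLocalRing ↥(tower O A m)) :
    NoZenoR := by
  refine DiscreteDominator.noZenoR_iff.mpr fun _ hD p hp k K _ _ _ _ O A hk hA hfr hAO => ?_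
  haveI := hfr
  obtain ⟨m₀, e, -, he⟩ := exists_ringKrullDim_tower_eventually_eq O A hA hfr hAO
  by_cases he2 : e ≤ 2
  · exact exists_isRegularLocalRing_tower_of_ringKrullDim_le_two hS p hp k K O A hk hA hfr hAO m₀
      (by rw [he m₀ le_rfl]; exact_mod_cast he2)
  · -- re-ground at `m₀`: an `F`-datum of dimension `e ≥ 3` with the same (top-dimensional) tower
    obtain ⟨F, A', hkF, hA'fg, hA'fr, hA'O, hdimA', htw⟩ :=
      Reground.exists_reground O A hk hA hfr hAO m₀ (h := e) (he m₀ le_rfl)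
    haveI : CharP ↥F p := (Algebra.charP_iff k ↥F p).mp inferInstance
    have hnot : ¬ ringKrullDim ↥A' ≤ 2 := by
      rw [hdimA']
      exact_mod_cast he2
    have htop : ∀ n : ℕ, ringKrullDim ↥(tower O A' n) = ringKrullDim ↥A' := by
      intro n
      have h1 : ringKrullDim ↥(tower O A (m₀ + n)) = ringKrullDim ↥(tower O A' n) :=
        ringKrullDim_eq_of_ringEquiv (RingEquiv.subringCongr (htw n).1)
      rw [← h1, he (m₀ + n) (Nat.le_add_right m₀ n), hdimA']
    obtain ⟨m, hm⟩ := hTop hD p hp (↥F) K O A' hkF hA'fg hA'fr hA'O hnot htop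
    exact ⟨m₀ + m, ((htw m).2).mpr hm⟩

/-- **`NoZenoR` ⟸ the six published surface facts + (TOP)** — as `noZenoR_of_surfaceTermination_of_topDim`, with the
kill test obtained from `StrictDrop` (available inside `NoZenoR`) by the tree's `surfaceTermination_of_strictDrop`
modulo CJS 2020, Lipman (1.2), (4.1), (12.1)(i),(ii) and Görtz–Wedhorn 24.44.
[cite: Lipman1969, Proposition (1.2), Theorem (4.1), Theorem (12.1) (i)–(ii)] [cite: GortzWedhorn2023, Cor. 24.44] -/
theorem noZenoR_of_facts_of_topDim
    (hF : (Literature.AlgebraicGeometry.Resolution.CossartJannsenSaito2020General.{0} ∧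
      Literature.AlgebraicGeometry.Resolution.Lipman1969_1_2.{0} ∧
      Literature.AlgebraicGeometry.Resolution.Lipman1969_4_1.{0} ∧
      Literature.AlgebraicGeometry.Resolution.Lipman1969_12_1_i.{0} ∧
      Literature.AlgebraicGeometry.Resolution.Lipman1969_12_1_ii.{0} ∧
      Literature.AlgebraicGeometry.Morphisms.GortzWedhorn2023_24_44_H2.{0}))
    (hTop : StrictDrop → ∀ p : ℕ, p.Prime → ∀ (k K : Type) [Field k] [CharP k p] [Field K] [Algebra k K]
      (O : ValuationSubring K) (A : Subalgebra k K), (∀ c : k, algebraMap k K c ∈ O) → A.FG →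
      IsFractionRing ↥A K → A.toSubring ≤ O.toSubring → ¬ ringKrullDim ↥A ≤ 2 →
      (∀ n : ℕ, ringKrullDim ↥(tower O A n) = ringKrullDim ↥A) → ∃ m : ℕ, IsRegularLocalRing ↥(tower O A m)) :
    NoZenoR := by
  by_cases hD : StrictDrop
  · exact noZenoR_of_surfaceTermination_of_topDim
      (SurfaceTermination.Reduction.surfaceTermination_of_strictDrop hF hD) hTop
  · exact fun _ hD' => absurd hD' hD

/-! ## Without `StrictDrop` as a hypothesis: universal termination from the kill test + (TOP′) -/

/-- **Universal termination of the canonical towers ⇒ `StrictDrop`** (fact-free): from a singular stage `T_m`, a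
regular stage `T_M` exists by hypothesis, regular stages persist (`tower_succ_eq_self_of_isRegularLocalRing`), so
`T_(max M (m+1))` is regular and later than `m`, and the endpoint calibration SC (`RegularDrop.stub_regular_drop`,
over S0 `TowerShape.stub_towerShape`) supplies the annihilator `1` of value below all of `ca(T_m) ∖ 0`. [folklore] -/
theorem strictDrop_of_forall_terminates
    (hT : ∀ p : ℕ, p.Prime → ∀ (k K : Type) [Field k] [CharP k p] [Field K] [Algebra k K]
      (O : ValuationSubring K) (A : Subalgebra k K), (∀ c : k, algebraMap k K c ∈ O) → A.FG →
      IsFractionRing ↥A K → A.toSubring ≤ O.toSubring → ∃ m : ℕ, IsRegularLocalRing ↥(tower O A m)) :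
    StrictDrop := by
  intro p hp k K _ _ _ _ O A hk hA hfr hAO ca loc chart nrm tower' m hm
  obtain ⟨M, hregM⟩ : ∃ M : ℕ, IsRegularLocalRing ↥(tower O A M) := hT p hp k K O A hk hA hfr hAO
  have hpersist : ∀ j : ℕ, IsRegularLocalRing ↥(tower O A (M + j)) := by
    intro j
    induction j with
    | zero => exact hregM
    | succ j ih =>
      have hstat : tower O A (M + j + 1) = tower O A (M + j) :=
        tower_succ_eq_self_of_isRegularLocalRing O A hk hfr hAO (M + j) ih
      rw [← Nat.add_assoc, hstat]
      exact ih
  obtain ⟨j, hj⟩ := Nat.exists_eq_add_of_le (le_max_left M (m + 1))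
  have hregn : IsRegularLocalRing ↥(tower O A (M + j)) := hpersist j
  have hmn : m < M + j := by
    rw [← hj]
    exact Nat.lt_of_lt_of_le (Nat.lt_succ_self m) (le_max_right M (m + 1))
  have hshape := StrictDrop.Birth.TowerShape.stub_towerShape p hp k K O A hk hA hfr hAO
  obtain ⟨y, hy, hy0, hval⟩ :=
    StrictDrop.Birth.RegularDrop.stub_regular_drop p hp k K O A hk hA hfr hAO hshape m (M + j) hm hregn
  exact ⟨M + j, hmn, y, hy, hy0, hval⟩

/-- **Universal termination ⟸ the kill test + (TOP′)**, where (TOP′) is (TOP) without the `StrictDrop` hypothesis: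
every admissible datum with `dim A ≥ 3` all of whose stages keep the top dimension `dim A` reaches a regular
stage.  Same proof as `noZenoR_of_surfaceTermination_of_topDim` (eventual constancy of the stage dimension,
`e ≤ 2` by the kill test, `e ≥ 3` by re-grounding into a top-dimensional `F`-datum). [folklore] -/
theorem forall_terminates_of_surfaceTermination_of_topDim' (hS : SurfaceTermination)
    (hTop : ∀ p : ℕ, p.Prime → ∀ (k K : Type) [Field k] [CharP k p] [Field K] [Algebra k K]
      (O : ValuationSubring K) (A : Subalgebra k K), (∀ c : k, algebraMap k K c ∈ O) → A.FG →
      IsFractionRing ↥A K → A.toSubring ≤ O.toSubring → ¬ ringKrullDim ↥A ≤ 2 →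
      (∀ n : ℕ, ringKrullDim ↥(tower O A n) = ringKrullDim ↥A) → ∃ m : ℕ, IsRegularLocalRing ↥(tower O A m))
    (p : ℕ) (hp : p.Prime) (k K : Type) [Field k] [CharP k p] [Field K] [Algebra k K]
    (O : ValuationSubring K) (A : Subalgebra k K) (hk : ∀ c : k, algebraMap k K c ∈ O) (hA : A.FG)
    (hfr : IsFractionRing ↥A K) (hAO : A.toSubring ≤ O.toSubring) :
    ∃ m : ℕ, IsRegularLocalRing ↥(tower O A m) := by
  haveI := hfr
  obtain ⟨m₀, e, -, he⟩ := exists_ringKrullDim_tower_eventually_eq O A hA hfr hAO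
  by_cases he2 : e ≤ 2
  · exact exists_isRegularLocalRing_tower_of_ringKrullDim_le_two hS p hp k K O A hk hA hfr hAO m₀
      (by rw [he m₀ le_rfl]; exact_mod_cast he2)
  · obtain ⟨F, A', hkF, hA'fg, hA'fr, hA'O, hdimA', htw⟩ :=
      Reground.exists_reground O A hk hA hfr hAO m₀ (h := e) (he m₀ le_rfl)
    haveI : CharP ↥F p := (Algebra.charP_iff k ↥F p).mp inferInstance
    have hnot : ¬ ringKrullDim ↥A' ≤ 2 := by
      rw [hdimA']
      exact_mod_cast he2
    have htop : ∀ n : ℕ, ringKrullDim ↥(tower O A' n) = ringKrullDim ↥A' := by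
      intro n
      have h1 : ringKrullDim ↥(tower O A (m₀ + n)) = ringKrullDim ↥(tower O A' n) :=
        ringKrullDim_eq_of_ringEquiv (RingEquiv.subringCongr (htw n).1)
      rw [← h1, he (m₀ + n) (Nat.le_add_right m₀ n), hdimA']
    obtain ⟨m, hm⟩ := hTop p hp (↥F) K O A' hkF hA'fg hA'fr hA'O hnot htop
    exact ⟨m₀ + m, ((htw m).2).mpr hm⟩

/-- **Crux `StrictDrop` ⟸ the kill test `SurfaceTermination` + (TOP′)** (crux BY NAME under hypotheses; fact-free). [folklore] -/
theorem strictDrop_of_surfaceTermination_of_topDim' (hS : SurfaceTermination)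
    (hTop : ∀ p : ℕ, p.Prime → ∀ (k K : Type) [Field k] [CharP k p] [Field K] [Algebra k K]
      (O : ValuationSubring K) (A : Subalgebra k K), (∀ c : k, algebraMap k K c ∈ O) → A.FG →
      IsFractionRing ↥A K → A.toSubring ≤ O.toSubring → ¬ ringKrullDim ↥A ≤ 2 →
      (∀ n : ℕ, ringKrullDim ↥(tower O A n) = ringKrullDim ↥A) → ∃ m : ℕ, IsRegularLocalRing ↥(tower O A m)) :
    StrictDrop :=
  strictDrop_of_forall_terminates fun p hp k K _ _ _ _ O A hk hA hfr hAO =>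
    forall_terminates_of_surfaceTermination_of_topDim' hS hTop p hp k K O A hk hA hfr hAO

/-- **Crux `NoZenoR` ⟸ the kill test `SurfaceTermination` + (TOP′)** (crux BY NAME under hypotheses; fact-free) —
so both open cruxes of the route reduce, modulo the kill test, to the ONE residual (TOP′): termination of the
canonical `ca`-towers of data of dimension `≥ 3` along valuations all of whose centres are closed points. [folklore] -/
theorem noZenoR_of_surfaceTermination_of_topDim' (hS : SurfaceTermination)
    (hTop : ∀ p : ℕ, p.Prime → ∀ (k K : Type) [Field k] [CharP k p] [Field K] [Algebra k K]
      (O : ValuationSubring K) (A : Subalgebra k K), (∀ c : k, algebraMap k K c ∈ O) → A.FG →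
      IsFractionRing ↥A K → A.toSubring ≤ O.toSubring → ¬ ringKrullDim ↥A ≤ 2 →
      (∀ n : ℕ, ringKrullDim ↥(tower O A n) = ringKrullDim ↥A) → ∃ m : ℕ, IsRegularLocalRing ↥(tower O A m)) :
    NoZenoR :=
  DiscreteDominator.noZenoR_iff.mpr fun _ _ p hp k K _ _ _ _ O A hk hA hfr hAO =>
    forall_terminates_of_surfaceTermination_of_topDim' hS hTop p hp k K O A hk hA hfr hAO

end Summit.ResolutionOfSingularities.ResolutionOfSingularities.Theorems.NoZeno.Birth.HighDimDoor

end
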